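import Mathlib.MeasureTheory.Measure.Haar.NormedSpace
import Mathlib.MeasureTheory.Group.LIntegral
import Mathlib.Analysis.SpecialFunctions.Integrals.Basic
import Mathlib.MeasureTheory.Integral.IntegralEqImproper
import Literature.Analysis.FluidPDE.LeraySelfSimilarCalculus
import Literature.Analysis.FluidPDE.SpaceTimeRescaling
import HarnessLib

/-!
# The change of variables behind Tsai 1998, (4.1): self-similar fields on a parabolic cylinder

Analysis/FluidPDE proofs-layer file (theorems only) in the decomposition of the named fact
`Literature.Analysis.FluidPDE.tsai1998_lemma41` (`TsaiLocalEnergy`; T.-P. Tsai, *On Leray's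
self-similar solutions of the Navier–Stokes equations satisfying local energy estimates*, Arch.
Rational Mech. Anal. 143 (1998), Lemma 4.1). For Leray's backward field
`u(t, x) = λ(t) U(λ(t) x)`, `λ(t) = (2a(T − t))^{-1/2}` (`lerayBackward a T U`), on the backward
cylinder `Q_ρ(0, T) = (T − ρ², T) × B_ρ(0)` Tsai computes (p. 44, **(4.1)**):

  `‖u(·,t)‖²_{2,B₁} = λ(t)⁻¹ ‖U‖²_{2,B_{λ(t)}}`,
  `∫∫_{Q₁} |u|^{10/3} = ∫ |U|^{10/3} A₁ min(|y|^{-5/3}, λ₀^{-5/3}) dy`,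
  `∫∫_{Q₁} |∇u|² = ∫ |∇U|² A₂ min(|y|⁻¹, λ₀⁻¹) dy`,

by the substitution `y = λ(t) x` at fixed `t` and an explicit time integration, and uses the same
computation backwards on p. 46 ("`p ∈ L^{5/3}(Q₁)` since `P̃ ∈ L^{5/3}_w`") for the pressure
`p = λ² P̃(λx)`. This file proves these changes of variables on `ℝ³` in `ℝ≥0∞`-valued form, with
explicit one-sided bounds for the time weights instead of the exact constants `A₁`, `A₂`:

* `setLIntegral_ball_comp_smul` — `∫_{B_ρ} F(Lx) dx = L⁻³ ∫_{B_{Lρ}} F` (`Measure.map_addHaar_smul`);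
* `setLIntegral_ball_profile_sq_le` — **(4.1)₁**: the energy bound
  `sup_t ∫_{B_ρ} |u(t)|² ≤ C` gives `∫_{B_R} |U|² ≤ (R/ρ) C` for `2aR² > 1`;
* `setLIntegral_mul_setLIntegral_ball_comp_lerayScale` — **Tonelli**:
  `∫_I Φ(t) ∫_{B_ρ} F(λ(t)x) dx dt = ∫ F(y) W(y) dy`, `W(y) = ∫_{I ∩ {|y| < λρ}} Φ λ⁻³ dt`;
* `lintegral_lerayScale_weight_one_ge` — for `Φ = λ⁴` (dissipation): `W(y) ≥ c min(1, |y|⁻¹)`,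
  `c = ρ min((2a)^{-1/2}, (2a)⁻¹)`;
* `lintegral_lerayScale_weight_third_le` — for `Φ = (λ²)^{5/3}` (the `L^{5/3}` pressure):
  `W(y) ≤ (6/5)(2a)⁻¹ρ^{5/3} |y|^{-5/3}` (here `∫₀^δ (2as)^{-1/6} ds` is evaluated with
  `integral_rpow`);
* `lintegral_frobeniusNormSq_profile_weight_lt_top` — **(4.1)₂**: `∫∫_{Q_ρ(0,T)} |∇u|² < ∞`
  gives `∫ |∇U|² min(1, |y|⁻¹) dy < ∞`;
* `lintegral_selfSimilarPressure_rpow_lt_top` — the converse for the pressure: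
  `∫ |P − k|^{5/3} |y|^{-5/3} < ∞` gives `∫∫_{Q_ρ(0,T)} |λ²(P(λx) − k)|^{5/3} < ∞`;
* `setLIntegral_prod_eq_setLIntegral_setLIntegral` — product sets versus iterated integrals.

(The `L^{10/3}` line of (4.1) is not needed as such: the weighted bound (4.3) on `U` is derived in
the sibling file on dyadic shells directly from (4.1)₁–(4.1)₂.)

## Mathlib / tree search

Mathlib: `Measure.map_addHaar_smul`, `lintegral_map_equiv`, `lintegral_lintegral_swap`,
`lintegral_sub_left_eq_self` (reflection `t ↦ T − t`), `integral_rpow`,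
`intervalIntegral.intervalIntegrable_rpow'`, `ofReal_integral_eq_lintegral_ofReal`,
`lintegral_prod`, `Measure.prod_restrict` (all used). Tree: `fderiv_lerayBackward`
(`LeraySelfSimilarCalculus`), `frobeniusNormSq_smul` (`SpaceTimeRescaling`); the `ℝ³` scaling
lemma `lintegral_comp_smul` exists in `RusinSverakCompactnessProofs`/`SolenoidalTruncation`
behind much heavier imports and is re-proved here (`lintegral_comp_smul_fin3`, 8 lines).

## References

* T.-P. Tsai, *On Leray's self-similar solutions of the Navier–Stokes equations satisfying local
  energy estimates*, Arch. Rational Mech. Anal. 143 (1998) 29–51: §4, (4.1)–(4.3) (p. 44–45),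
  Lemma 4.1 (p. 46) [Tsai1998].
-/

noncomputable section

open MeasureTheory Set Function Filter Topology Metric
open scoped ENNReal NNReal

namespace Literature.Analysis.FluidPDE

/-! ### Dilations of Lebesgue measure on `ℝ³` -/

section Space

/-- `∫ F(L x) dx = L⁻³ ∫ F` on `ℝ³` for `L > 0` (Mathlib `Measure.map_addHaar_smul`), as a lower
Lebesgue integral. [folklore] -/
theorem lintegral_comp_smul_fin3 (F : (EuclideanSpace ℝ (Fin 3)) → ℝ≥0∞) {L : ℝ} (hL : 0 < L) :
    ∫⁻ x, F (L • x) = ENNReal.ofReal ((L ^ 3)⁻¹) * ∫⁻ y, F y := by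
  have hL0 : L ≠ 0 := hL.ne'
  calc ∫⁻ x, F (L • x) = ∫⁻ y, F y ∂(Measure.map (fun x : (EuclideanSpace ℝ (Fin 3)) => L • x) volume) :=
        (lintegral_map_equiv F
          (Homeomorph.smul (isUnit_iff_ne_zero.2 hL0).unit).toMeasurableEquiv).symm
    _ = ENNReal.ofReal ((L ^ 3)⁻¹) * ∫⁻ y, F y := by
        rw [Measure.map_addHaar_smul volume hL0, lintegral_smul_measure, smul_eq_mul,
          finrank_euclideanSpace_fin, abs_of_nonneg (inv_nonneg.2 (pow_nonneg hL.le 3))]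

/-- **Dilation of a ball integral**: `∫_{B_ρ} F(L x) dx = L⁻³ ∫_{B_{Lρ}} F(y) dy` on `ℝ³`, `L > 0`
(the substitution `y = λx` of Tsai 1998, (4.1)). [cite: Tsai1998, (4.1) p. 44] -/
theorem setLIntegral_ball_comp_smul (F : (EuclideanSpace ℝ (Fin 3)) → ℝ≥0∞) {L : ℝ} (hL : 0 < L) (ρ : ℝ) :
    ∫⁻ x in ball 0 ρ, F (L • x) = ENNReal.ofReal ((L ^ 3)⁻¹) * ∫⁻ y in ball 0 (L * ρ), F y := by
  have hind : ∀ x : (EuclideanSpace ℝ (Fin 3)), (ball (0 : (EuclideanSpace ℝ (Fin 3))) ρ).indicator (fun x => F (L • x)) x =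
      (ball (0 : (EuclideanSpace ℝ (Fin 3))) (L * ρ)).indicator F (L • x) := by
    intro x
    have hiff : x ∈ ball (0 : (EuclideanSpace ℝ (Fin 3))) ρ ↔ L • x ∈ ball (0 : (EuclideanSpace ℝ (Fin 3))) (L * ρ) := by
      rw [mem_ball_zero_iff, mem_ball_zero_iff, norm_smul, Real.norm_of_nonneg hL.le,
        mul_lt_mul_iff_of_pos_left hL]
    by_cases hx : x ∈ ball (0 : (EuclideanSpace ℝ (Fin 3))) ρ
    · rw [indicator_of_mem hx, indicator_of_mem (hiff.1 hx)]
    · rw [indicator_of_notMem hx, indicator_of_notMem (fun h => hx (hiff.2 h))]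
  rw [← lintegral_indicator measurableSet_ball, ← lintegral_indicator measurableSet_ball,
    funext hind, lintegral_comp_smul_fin3 _ hL]

end Space

/-! ### The scale factor and the self-similar field on `ℝ³` -/

section Scale

variable {a T ρ : ℝ}

/-- Measurability of `t ↦ λ(t) = (√(2a(T − t)))⁻¹` (on all of `ℝ`, junk included). [folklore] -/
theorem measurable_lerayScale (a T : ℝ) : Measurable fun t : ℝ => (Real.sqrt (2 * a * (T - t)))⁻¹ :=
  (Real.continuous_sqrt.comp (by fun_prop)).measurable.inv

/-- `λ(t) > 0` for `t < T` (`a > 0`). [folklore] -/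
theorem lerayScale_pos' (ha : 0 < a) {t : ℝ} (ht : t < T) : 0 < (Real.sqrt (2 * a * (T - t)))⁻¹ :=
  inv_pos.2 (Real.sqrt_pos.2 (mul_pos (mul_pos two_pos ha) (sub_pos.2 ht)))

/-- `λ(t)² = (2a(T − t))⁻¹` for `t < T`. [folklore] -/
theorem lerayScale_sq' (ha : 0 < a) {t : ℝ} (ht : t < T) :
    ((Real.sqrt (2 * a * (T - t)))⁻¹) ^ 2 = (2 * a * (T - t))⁻¹ := by
  rw [inv_pow, Real.sq_sqrt (mul_pos (mul_pos two_pos ha) (sub_pos.2 ht)).le]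

/-- **The threshold time.** For `t < T` and `r > 0`: `r < λ(t) ρ` forces `T − t < ρ²/(2a r²)`
(square and use `λ² = (2a(T−t))⁻¹`). [folklore] -/
theorem sub_lt_of_lt_lerayScale_mul (ha : 0 < a) {t r : ℝ} (ht : t < T) (hr : 0 < r)
    (h : r < (Real.sqrt (2 * a * (T - t)))⁻¹ * ρ) : T - t < ρ ^ 2 / (2 * a * r ^ 2) := by
  have h2 : r ^ 2 < ((Real.sqrt (2 * a * (T - t)))⁻¹) ^ 2 * ρ ^ 2 := by
    rw [← mul_pow]
    exact pow_lt_pow_left₀ h hr.le two_ne_zero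
  have hpos : 0 < 2 * a * (T - t) := mul_pos (mul_pos two_pos ha) (sub_pos.2 ht)
  rw [lerayScale_sq' ha ht, inv_mul_eq_div, lt_div_iff₀ hpos] at h2
  rw [lt_div_iff₀ (by positivity)]
  have : (T - t) * (2 * a * r ^ 2) = r ^ 2 * (2 * a * (T - t)) := by ring
  rw [this]
  exact h2

/-- Conversely, for `t < T` with `T − t < ρ²/(2a r²)` (`r > 0`, `ρ > 0`): `r < λ(t) ρ`. [folklore] -/
theorem lt_lerayScale_mul_of_sub_lt (ha : 0 < a) (hρ : 0 < ρ) {t r : ℝ} (ht : t < T) (hr : 0 < r)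
    (h : T - t < ρ ^ 2 / (2 * a * r ^ 2)) : r < (Real.sqrt (2 * a * (T - t)))⁻¹ * ρ := by
  have hL := lerayScale_pos' ha ht
  have hpos : 0 < 2 * a * (T - t) := mul_pos (mul_pos two_pos ha) (sub_pos.2 ht)
  have h2 : r ^ 2 < ((Real.sqrt (2 * a * (T - t)))⁻¹ * ρ) ^ 2 := by
    rw [mul_pow, lerayScale_sq' ha ht, inv_mul_eq_div, lt_div_iff₀ hpos]
    rw [lt_div_iff₀ (by positivity)] at h
    nlinarith
  exact lt_of_pow_lt_pow_left₀ 2 (mul_pos hL hρ).le h2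

end Scale

/-! ### (4.1)₁: the energy hypothesis in profile variables -/

section Energy

variable {a T ρ : ℝ}

/-- `∫_{B_{Lρ}} |U|² = L ∫_{B_ρ} |u(t_L)|²` at the time `t_L = T − (2aL²)⁻¹` where `λ(t_L) = L`
(Tsai 1998, (4.1)₁: `‖u(·, t)‖_{2,B₁} = λ(t)^{-1/2} ‖U‖_{2,B_{λ(t)}}`). [cite: Tsai1998, (4.1) p. 44] -/
theorem setLIntegral_ball_profile_sq_eq (ha : 0 < a) (U : (EuclideanSpace ℝ (Fin 3)) → (EuclideanSpace ℝ (Fin 3))) {L : ℝ} (hL : 0 < L) (T ρ : ℝ) :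
    ∫⁻ y in ball 0 (L * ρ), ‖U y‖ₑ ^ 2 =
      ENNReal.ofReal L * ∫⁻ x in ball 0 ρ, ‖lerayBackward a T U (T - (2 * a * L ^ 2)⁻¹) x‖ₑ ^ 2 := by
  have h1 : 2 * a * (T - (T - (2 * a * L ^ 2)⁻¹)) = (L ^ 2)⁻¹ := by
    rw [sub_sub_cancel]
    field_simp
  have h2 : Real.sqrt ((L ^ 2)⁻¹) = L⁻¹ := by
    rw [Real.sqrt_inv, Real.sqrt_sq hL.le]
  have h3 : ∀ x, lerayBackward a T U (T - (2 * a * L ^ 2)⁻¹) x = L • U (L • x) := fun x => by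
    simp only [lerayBackward_apply, h1, h2, inv_inv]
  simp_rw [h3, enorm_smul, mul_pow]
  rw [lintegral_const_mul' _ _ (by simp), setLIntegral_ball_comp_smul (fun y => ‖U y‖ₑ ^ 2) hL ρ,
    ← mul_assoc, ← mul_assoc]
  have hc : ENNReal.ofReal L * ‖L‖ₑ ^ 2 * ENNReal.ofReal ((L ^ 3)⁻¹) = 1 := by
    rw [Real.enorm_eq_ofReal hL.le, ← ENNReal.ofReal_pow hL.le, ← ENNReal.ofReal_mul hL.le,
      ← ENNReal.ofReal_mul (by positivity), ← ENNReal.ofReal_one]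
    congr 1
    field_simp
  rw [hc, one_mul]

/-- **(4.1)₁ as a bound**: if `sup_{T−ρ² < t < T} ∫_{B_ρ} |u(t)|² ≤ C` for the self-similar field
`u = lerayBackward a T U`, then `∫_{B_R} |U|² ≤ (R/ρ) C` for every radius `R` with `2aR² > 1`
(i.e. `R > λ(T − ρ²) ρ = (2a)^{-1/2}`; Tsai 1998, (4.1)₁ and "Hence all the right-hand sides are
finite"). [cite: Tsai1998, (4.1) p. 44] -/
theorem setLIntegral_ball_profile_sq_le (ha : 0 < a) (hρ : 0 < ρ) {U : (EuclideanSpace ℝ (Fin 3)) → (EuclideanSpace ℝ (Fin 3))} {C : ℝ≥0∞}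
    (hE : ∀ t ∈ Ioo (T - ρ ^ 2) T, ∫⁻ x in ball (0 : (EuclideanSpace ℝ (Fin 3))) ρ, ‖lerayBackward a T U t x‖ₑ ^ 2 ≤ C)
    {R : ℝ} (hR0 : 0 < R) (hR : 1 < 2 * a * R ^ 2) :
    ∫⁻ y in ball 0 R, ‖U y‖ₑ ^ 2 ≤ ENNReal.ofReal (R / ρ) * C := by
  set L : ℝ := R / ρ with hL_def
  have hL : 0 < L := div_pos hR0 hρ
  have hLρ : L * ρ = R := div_mul_cancel₀ R hρ.ne'
  have ht : T - (2 * a * L ^ 2)⁻¹ ∈ Ioo (T - ρ ^ 2) T := by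
    refine ⟨?_, sub_lt_self _ (by positivity)⟩
    have h1 : (2 * a * L ^ 2)⁻¹ < ρ ^ 2 := by
      rw [inv_lt_iff_one_lt_mul₀ (by positivity), hL_def, div_pow]
      have : 2 * a * (R ^ 2 / ρ ^ 2) * ρ ^ 2 = 2 * a * R ^ 2 := by field_simp
      linarith
    linarith
  rw [← hLρ, setLIntegral_ball_profile_sq_eq ha U hL T ρ]
  exact mul_le_mul_right (hE _ ht) _

end Energy

/-! ### Tonelli: space–time integrals of dilated densities as weighted profile integrals -/

section Swap

variable {a T ρ : ℝ}

/-- **The change of variables (4.1), general form.** For measurable `F ≥ 0` on `ℝ³`, a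
measurable time weight `Φ ≥ 0` and a measurable set of times `I ⊆ (-∞, T)`,
`∫_I Φ(t) ∫_{B_ρ} F(λ(t)x) dx dt = ∫_{ℝ³} F(y) W(y) dy` with the weight
`W(y) = ∫_{I ∩ {t : |y| < λ(t)ρ}} Φ(t) λ(t)⁻³ dt` (substitute `y = λ(t)x` at fixed `t`, then
Tonelli; Tsai 1998, (4.1), where `I = (T − 1, T)`, `ρ = 1`, `Φ = λ^{10/3}` resp. `λ⁴` give the
weights `A₁ min(|y|^{-5/3}, λ₀^{-5/3})` and `A₂ min(|y|⁻¹, λ₀⁻¹)`). [cite: Tsai1998, (4.1) p. 44] -/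
theorem setLIntegral_mul_setLIntegral_ball_comp_lerayScale (ha : 0 < a) {I : Set ℝ}
    (hI : MeasurableSet I) (hIT : I ⊆ Iio T) {F : (EuclideanSpace ℝ (Fin 3)) → ℝ≥0∞} (hF : Measurable F) {Φ : ℝ → ℝ≥0∞}
    (hΦ : Measurable Φ) (ρ : ℝ) :
    ∫⁻ t in I, Φ t * ∫⁻ x in ball (0 : (EuclideanSpace ℝ (Fin 3))) ρ, F ((Real.sqrt (2 * a * (T - t)))⁻¹ • x) =
      ∫⁻ y, F y * ∫⁻ t in I, {t : ℝ | ‖y‖ < (Real.sqrt (2 * a * (T - t)))⁻¹ * ρ}.indicator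
        (fun t => Φ t * ENNReal.ofReal ((((Real.sqrt (2 * a * (T - t)))⁻¹) ^ 3)⁻¹)) t := by
  set lam : ℝ → ℝ := fun t => (Real.sqrt (2 * a * (T - t)))⁻¹ with hlam
  have hlm : Measurable lam := measurable_lerayScale a T
  -- the joint integrand
  set S : Set (ℝ × (EuclideanSpace ℝ (Fin 3))) := {p | ‖p.2‖ < lam p.1 * ρ} with hS
  have hSm : MeasurableSet S :=
    measurableSet_lt measurable_snd.norm ((hlm.comp measurable_fst).mul_const ρ)
  set g : ℝ → (EuclideanSpace ℝ (Fin 3)) → ℝ≥0∞ := fun t y =>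
    S.indicator (fun p => Φ p.1 * ENNReal.ofReal (((lam p.1) ^ 3)⁻¹) * F p.2) (t, y) with hg
  have hgm : Measurable (uncurry g) := by
    have : uncurry g = S.indicator (fun p => Φ p.1 * ENNReal.ofReal (((lam p.1) ^ 3)⁻¹) * F p.2) := by
      funext p; rfl
    rw [this]
    exact (((hΦ.comp measurable_fst).mul ((hlm.comp measurable_fst).pow_const 3).inv.ennreal_ofReal).mul
      (hF.comp measurable_snd)).indicator hSm
  -- step 1: the inner substitution at fixed `t ∈ I`
  have step1 : ∀ t ∈ I, Φ t * ∫⁻ x in ball (0 : (EuclideanSpace ℝ (Fin 3))) ρ, F (lam t • x) = ∫⁻ y, g t y := by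
    intro t ht
    have hL : 0 < lam t := lerayScale_pos' ha (hIT ht)
    rw [setLIntegral_ball_comp_smul F hL ρ, ← lintegral_indicator measurableSet_ball, ← mul_assoc,
      ← lintegral_const_mul _ (hF.indicator measurableSet_ball)]
    refine lintegral_congr fun y => ?_
    simp only [hg]
    by_cases hy : ‖y‖ < lam t * ρ
    · have h1 : y ∈ ball (0 : (EuclideanSpace ℝ (Fin 3))) (lam t * ρ) := mem_ball_zero_iff.2 hy
      have h2 : (t, y) ∈ S := hy
      rw [indicator_of_mem h1, indicator_of_mem h2]
    · have h1 : y ∉ ball (0 : (EuclideanSpace ℝ (Fin 3))) (lam t * ρ) := fun h => hy (mem_ball_zero_iff.1 h)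
      have h2 : (t, y) ∉ S := hy
      rw [indicator_of_notMem h1, indicator_of_notMem h2, mul_zero]
  -- step 2: swap
  rw [setLIntegral_congr_fun hI step1,
    lintegral_lintegral_swap (hgm.aemeasurable (μ := (volume.restrict I).prod volume))]
  -- step 3: pull `F y` out of the time integral
  refine lintegral_congr fun y => ?_
  have hpt : ∀ t, g t y = F y * {t : ℝ | ‖y‖ < lam t * ρ}.indicator
      (fun t => Φ t * ENNReal.ofReal (((lam t) ^ 3)⁻¹)) t := by
    intro t
    simp only [hg]
    by_cases hy : ‖y‖ < lam t * ρ
    · have h2 : (t, y) ∈ S := hy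
      have h3 : t ∈ {t : ℝ | ‖y‖ < lam t * ρ} := hy
      rw [indicator_of_mem h2, indicator_of_mem h3, mul_comm]
    · have h2 : (t, y) ∉ S := hy
      have h3 : t ∉ {t : ℝ | ‖y‖ < lam t * ρ} := hy
      rw [indicator_of_notMem h2, indicator_of_notMem h3, mul_zero]
  simp_rw [hpt]
  rw [lintegral_const_mul]
  exact ((hΦ.mul (hlm.pow_const 3).inv.ennreal_ofReal).indicator
    (measurableSet_lt measurable_const (hlm.mul_const ρ)))

end Swap

/-! ### The two time weights: `∫ λ dt ≳ min(1, |y|⁻¹)` and `∫ λ^{1/3} dt ≲ |y|^{-5/3}` -/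

section Weights

variable {a T ρ : ℝ}

/-- **Lower bound for the dissipation weight** (the `α = 4` case of (4.1): `A₂ min(|y|⁻¹, λ₀⁻¹)`).
For every `y`, `∫_{(T−ρ²,T) ∩ {|y| < λρ}} λ⁴ · λ⁻³ dt ≥ c · min(1, |y|⁻¹)` with
`c = ρ min((2a)^{-1/2}, (2a)⁻¹) > 0`: if `|y| ≤ (2a)^{-1/2}` every `t` qualifies and `λ > λ(T−ρ²)`;
otherwise the times `T − t < ρ²/(2a|y|²)` qualify and there `λ > |y|/ρ`. [cite: Tsai1998, (4.1) p. 44] -/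
theorem lintegral_lerayScale_weight_one_ge (ha : 0 < a) (hρ : 0 < ρ) (T : ℝ) (y : (EuclideanSpace ℝ (Fin 3))) :
    ENNReal.ofReal (ρ * min (Real.sqrt (2 * a))⁻¹ (2 * a)⁻¹ * min 1 ‖y‖⁻¹) ≤
      ∫⁻ t in Ioo (T - ρ ^ 2) T, {t : ℝ | ‖y‖ < (Real.sqrt (2 * a * (T - t)))⁻¹ * ρ}.indicator
        (fun t => ENNReal.ofReal (((Real.sqrt (2 * a * (T - t)))⁻¹) ^ 4) *
          ENNReal.ofReal ((((Real.sqrt (2 * a * (T - t)))⁻¹) ^ 3)⁻¹)) t := by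
  set lam : ℝ → ℝ := fun t => (Real.sqrt (2 * a * (T - t)))⁻¹ with hlam
  set r : ℝ := ‖y‖ with hr_def
  have hr0 : 0 ≤ r := norm_nonneg _
  set c₁ : ℝ := (Real.sqrt (2 * a))⁻¹ with hc₁
  have h2a : 0 < 2 * a := by positivity
  have hc₁pos : 0 < c₁ := inv_pos.2 (Real.sqrt_pos.2 h2a)
  have hc₁sq : c₁ ^ 2 = (2 * a)⁻¹ := by rw [hc₁, inv_pow, Real.sq_sqrt h2a.le]
  -- the integrand on qualifying times equals `λ`, and `λ ≥` the relevant threshold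
  have hint_eq : ∀ t, t < T → ENNReal.ofReal ((lam t) ^ 4) * ENNReal.ofReal (((lam t) ^ 3)⁻¹) =
      ENNReal.ofReal (lam t) := by
    intro t ht
    have hL := lerayScale_pos' (T := T) ha ht
    rw [← ENNReal.ofReal_mul (by positivity)]
    congr 1
    field_simp
  have hmin_le : ρ * min c₁ (2 * a)⁻¹ * min 1 r⁻¹ ≤ ρ * c₁ := by
    have h1 : min c₁ (2 * a)⁻¹ ≤ c₁ := min_le_left _ _
    have h2 : min 1 r⁻¹ ≤ 1 := min_le_left _ _
    have h3 : 0 ≤ min 1 r⁻¹ := le_min zero_le_one (inv_nonneg.2 hr0)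
    calc ρ * min c₁ (2 * a)⁻¹ * min 1 r⁻¹ ≤ ρ * c₁ * 1 := by gcongr
      _ = ρ * c₁ := mul_one _
  -- `c₁ / ρ = λ(T − ρ²)`
  have hc₁ρ : c₁ / ρ = (Real.sqrt (2 * a * ρ ^ 2))⁻¹ := by
    rw [hc₁, Real.sqrt_mul h2a.le, Real.sqrt_sq hρ.le, mul_inv, div_eq_mul_inv]
  have hmeasI : MeasurableSet (Ioo (T - ρ ^ 2) T) := measurableSet_Ioo
  by_cases hcase : r ≤ c₁
  · -- every time in `(T − ρ², T)` qualifies, and there `λ > λ(T − ρ²) = c₁/ρ`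
    have hqual : ∀ t ∈ Ioo (T - ρ ^ 2) T, c₁ / ρ < lam t := by
      intro t ht
      have hpos : 0 < 2 * a * (T - t) := mul_pos h2a (sub_pos.2 ht.2)
      rw [hc₁ρ, hlam]
      simp only
      rw [inv_lt_inv₀ (Real.sqrt_pos.2 (by positivity)) (Real.sqrt_pos.2 hpos)]
      refine Real.sqrt_lt_sqrt hpos.le ?_
      have : T - t < ρ ^ 2 := by linarith [ht.1]
      exact mul_lt_mul_of_pos_left this h2a
    calc ENNReal.ofReal (ρ * min c₁ (2 * a)⁻¹ * min 1 r⁻¹)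
        ≤ ENNReal.ofReal (c₁ / ρ) * volume (Ioo (T - ρ ^ 2) T) := by
          rw [Real.volume_Ioo, ← ENNReal.ofReal_mul (by positivity)]
          refine ENNReal.ofReal_le_ofReal (hmin_le.trans_eq ?_)
          field_simp
          ring
      _ = ∫⁻ _ in Ioo (T - ρ ^ 2) T, ENNReal.ofReal (c₁ / ρ) := (setLIntegral_const _ _).symm
      _ ≤ _ := by
          refine setLIntegral_mono' hmeasI fun t ht => ?_
          have h1 := hqual t ht
          have hmem : t ∈ {t : ℝ | ‖y‖ < (Real.sqrt (2 * a * (T - t)))⁻¹ * ρ} := by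
            show r < lam t * ρ
            calc r ≤ c₁ := hcase
              _ = c₁ / ρ * ρ := (div_mul_cancel₀ c₁ hρ.ne').symm
              _ < lam t * ρ := mul_lt_mul_of_pos_right h1 hρ
          rw [indicator_of_mem hmem, hint_eq t ht.2]
          exact ENNReal.ofReal_le_ofReal h1.le
  · -- the times `T − t < δ = ρ²/(2a r²)` qualify, and there `λ > r/ρ`
    push Not at hcase
    have hr : 0 < r := hc₁pos.trans hcase
    set δ : ℝ := ρ ^ 2 / (2 * a * r ^ 2) with hδ
    have hδpos : 0 < δ := by positivity
    have hδlt : δ < ρ ^ 2 := by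
      rw [hδ, div_lt_iff₀ (by positivity)]
      have hr2 : (2 * a)⁻¹ < r ^ 2 := by
        rw [← hc₁sq]
        exact pow_lt_pow_left₀ hcase hc₁pos.le two_ne_zero
      have : 1 < 2 * a * r ^ 2 := by
        rw [inv_lt_iff_one_lt_mul₀ h2a] at hr2
        linarith
      have hρ2 : 0 < ρ ^ 2 := by positivity
      calc ρ ^ 2 = ρ ^ 2 * 1 := (mul_one _).symm
        _ < ρ ^ 2 * (2 * a * r ^ 2) := mul_lt_mul_of_pos_left this hρ2
    have hsub : Ioo (T - δ) T ⊆ Ioo (T - ρ ^ 2) T := Ioo_subset_Ioo (by linarith) le_rfl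
    have hqual : ∀ t ∈ Ioo (T - δ) T, r < lam t * ρ := fun t ht =>
      lt_lerayScale_mul_of_sub_lt ha hρ ht.2 hr (by linarith [ht.1])
    calc ENNReal.ofReal (ρ * min c₁ (2 * a)⁻¹ * min 1 r⁻¹)
        ≤ ENNReal.ofReal (r / ρ) * volume (Ioo (T - δ) T) := by
          rw [Real.volume_Ioo, ← ENNReal.ofReal_mul (by positivity)]
          refine ENNReal.ofReal_le_ofReal ?_
          have h1 : min c₁ (2 * a)⁻¹ ≤ (2 * a)⁻¹ := min_le_right _ _
          have h2 : min 1 r⁻¹ ≤ r⁻¹ := min_le_right _ _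
          have h3 : 0 ≤ min 1 r⁻¹ := le_min zero_le_one (inv_nonneg.2 hr0)
          calc ρ * min c₁ (2 * a)⁻¹ * min 1 r⁻¹ ≤ ρ * (2 * a)⁻¹ * r⁻¹ := by gcongr
            _ = r / ρ * (T - (T - δ)) := by
                rw [sub_sub_cancel, hδ]
                field_simp
      _ = ∫⁻ _ in Ioo (T - δ) T, ENNReal.ofReal (r / ρ) := (setLIntegral_const _ _).symm
      _ ≤ ∫⁻ t in Ioo (T - δ) T, {t : ℝ | ‖y‖ < (Real.sqrt (2 * a * (T - t)))⁻¹ * ρ}.indicator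
          (fun t => ENNReal.ofReal (((Real.sqrt (2 * a * (T - t)))⁻¹) ^ 4) *
            ENNReal.ofReal ((((Real.sqrt (2 * a * (T - t)))⁻¹) ^ 3)⁻¹)) t := by
          refine setLIntegral_mono' measurableSet_Ioo fun t ht => ?_
          have h1 := hqual t ht
          have hmem : t ∈ {t : ℝ | ‖y‖ < (Real.sqrt (2 * a * (T - t)))⁻¹ * ρ} := h1
          rw [indicator_of_mem hmem, hint_eq t ht.2]
          refine ENNReal.ofReal_le_ofReal ?_
          rw [div_le_iff₀ hρ]
          exact h1.le
      _ ≤ _ := lintegral_mono_set hsub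

/-- Reflection of the time variable: `∫_{(T−δ, T)} G(T − t) dt = ∫_{(0, δ)} G(s) ds`. [folklore] -/
theorem setLIntegral_Ioo_comp_sub_left (G : ℝ → ℝ≥0∞) (T δ : ℝ) :
    ∫⁻ t in Ioo (T - δ) T, G (T - t) = ∫⁻ s in Ioo 0 δ, G s := by
  rw [← lintegral_indicator measurableSet_Ioo, ← lintegral_indicator measurableSet_Ioo]
  have h : (fun t => (Ioo (T - δ) T).indicator (fun t => G (T - t)) t) =
      fun t => ((Ioo 0 δ).indicator G) (T - t) := by
    funext t
    by_cases ht : t ∈ Ioo (T - δ) T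
    · have ht' : T - t ∈ Ioo 0 δ := ⟨by linarith [ht.2], by linarith [ht.1]⟩
      rw [indicator_of_mem ht, indicator_of_mem ht']
    · have ht' : T - t ∉ Ioo 0 δ := fun h => ht ⟨by linarith [h.2], by linarith [h.1]⟩
      rw [indicator_of_notMem ht, indicator_of_notMem ht']
  rw [h, lintegral_sub_left_eq_self]

/-- `∫_{(0,δ)} s^{-1/6} ds = (6/5) δ^{5/6}` as a lower Lebesgue integral (`δ > 0`; Mathlib
`integral_rpow`). [folklore] -/
theorem setLIntegral_Ioo_rpow_neg_sixth {δ : ℝ} (hδ : 0 < δ) :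
    ∫⁻ s in Ioo 0 δ, ENNReal.ofReal (s ^ (-(1 / 6) : ℝ)) =
      ENNReal.ofReal (6 / 5 * δ ^ (5 / 6 : ℝ)) := by
  have hr : (-1 : ℝ) < -(1 / 6) := by norm_num
  have hint : IntervalIntegrable (fun s : ℝ => s ^ (-(1 / 6) : ℝ)) volume 0 δ :=
    intervalIntegral.intervalIntegrable_rpow' hr
  have hIO : IntegrableOn (fun s : ℝ => s ^ (-(1 / 6) : ℝ)) (Ioo 0 δ) :=
    hint.1.mono_set Ioo_subset_Ioc_self
  have hnn : 0 ≤ᵐ[volume.restrict (Ioo 0 δ)] fun s : ℝ => s ^ (-(1 / 6) : ℝ) :=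
    ae_restrict_of_forall_mem measurableSet_Ioo fun s hs => Real.rpow_nonneg hs.1.le _
  rw [← ofReal_integral_eq_lintegral_ofReal hIO hnn, ← integral_Ioc_eq_integral_Ioo,
    ← intervalIntegral.integral_of_le hδ.le, integral_rpow (Or.inl hr),
    Real.zero_rpow (by norm_num), sub_zero]
  congr 1
  norm_num
  ring

/-- The pressure-weight integrand in terms of `2a(T − t)`: for `t < T`,
`(λ²)^{5/3} · λ⁻³ = (2a(T−t))^{-1/6}` (in `ℝ≥0∞`). [folklore] -/
theorem ofReal_lerayScale_sq_rpow_mul (ha : 0 < a) {t : ℝ} (ht : t < T) :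
    ENNReal.ofReal (((Real.sqrt (2 * a * (T - t)))⁻¹) ^ 2) ^ (5 / 3 : ℝ) *
        ENNReal.ofReal ((((Real.sqrt (2 * a * (T - t)))⁻¹) ^ 3)⁻¹) =
      ENNReal.ofReal ((2 * a * (T - t)) ^ (-(1 / 6) : ℝ)) := by
  set g : ℝ := 2 * a * (T - t) with hg
  have hgpos : 0 < g := mul_pos (mul_pos two_pos ha) (sub_pos.2 ht)
  have hsqrt : Real.sqrt g = g ^ (1 / 2 : ℝ) := Real.sqrt_eq_rpow g
  have h1 : ((Real.sqrt g)⁻¹) ^ 2 = g⁻¹ := by rw [inv_pow, Real.sq_sqrt hgpos.le]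
  have h2 : (((Real.sqrt g)⁻¹) ^ 3)⁻¹ = g ^ (3 / 2 : ℝ) := by
    rw [inv_pow, inv_inv, hsqrt, ← Real.rpow_natCast, ← Real.rpow_mul hgpos.le]
    norm_num
  rw [ENNReal.ofReal_rpow_of_nonneg (sq_nonneg _) (by norm_num), ← ENNReal.ofReal_mul
    (Real.rpow_nonneg (sq_nonneg _) _), h1, h2, Real.inv_rpow hgpos.le, ← Real.rpow_neg hgpos.le,
    ← Real.rpow_add hgpos]
  norm_num

/-- **Upper bound for the pressure weight** (the `α = 10/3` case of (4.1):
`A₁ min(|y|^{-5/3}, λ₀^{-5/3})`). For every `y`,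
`∫_{(T−ρ²,T) ∩ {|y| < λρ}} (λ²)^{5/3} λ⁻³ dt ≤ (6/5)(2a)⁻¹ ρ^{5/3} |y|^{-5/3}`: the qualifying times
satisfy `T − t < ρ²/(2a|y|²)`, and `∫₀^δ (2as)^{-1/6} ds = (6/5)(2a)^{-1/6} δ^{5/6}` (the right-hand
side is `+∞` at `y = 0`, where the bound is void). [cite: Tsai1998, (4.1) p. 44] -/
theorem lintegral_lerayScale_weight_third_le (ha : 0 < a) (hρ : 0 < ρ) (T : ℝ) (y : (EuclideanSpace ℝ (Fin 3))) :
    ∫⁻ t in Ioo (T - ρ ^ 2) T, {t : ℝ | ‖y‖ < (Real.sqrt (2 * a * (T - t)))⁻¹ * ρ}.indicator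
        (fun t => ENNReal.ofReal (((Real.sqrt (2 * a * (T - t)))⁻¹) ^ 2) ^ (5 / 3 : ℝ) *
          ENNReal.ofReal ((((Real.sqrt (2 * a * (T - t)))⁻¹) ^ 3)⁻¹)) t ≤
      ENNReal.ofReal (6 / 5 * (2 * a)⁻¹ * ρ ^ (5 / 3 : ℝ)) * ‖y‖ₑ ^ (-(5 / 3) : ℝ) := by
  have h2a : 0 < 2 * a := by positivity
  have hC : 0 < 6 / 5 * (2 * a)⁻¹ * ρ ^ (5 / 3 : ℝ) := by positivity
  by_cases hy : y = 0
  · subst hy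
    rw [enorm_zero, ENNReal.zero_rpow_of_neg (by norm_num), ENNReal.mul_top
      (ENNReal.ofReal_pos.2 hC).ne']
    exact le_top
  set r : ℝ := ‖y‖ with hr_def
  have hr : 0 < r := norm_pos_iff.2 hy
  set δ : ℝ := ρ ^ 2 / (2 * a * r ^ 2) with hδ
  have hδpos : 0 < δ := by positivity
  -- step 1: only times with `T − t < δ` contribute, with integrand `(2a(T−t))^{-1/6}`
  have step1 : ∫⁻ t in Ioo (T - ρ ^ 2) T, {t : ℝ | ‖y‖ < (Real.sqrt (2 * a * (T - t)))⁻¹ * ρ}.indicator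
        (fun t => ENNReal.ofReal (((Real.sqrt (2 * a * (T - t)))⁻¹) ^ 2) ^ (5 / 3 : ℝ) *
          ENNReal.ofReal ((((Real.sqrt (2 * a * (T - t)))⁻¹) ^ 3)⁻¹)) t ≤
      ∫⁻ t in Ioo (T - δ) T, ENNReal.ofReal ((2 * a * (T - t)) ^ (-(1 / 6) : ℝ)) := by
    rw [← lintegral_indicator measurableSet_Ioo, ← lintegral_indicator measurableSet_Ioo]
    refine lintegral_mono fun t => ?_
    by_cases ht : t ∈ Ioo (T - ρ ^ 2) T
    · rw [indicator_of_mem ht]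
      by_cases hA : t ∈ {t : ℝ | ‖y‖ < (Real.sqrt (2 * a * (T - t)))⁻¹ * ρ}
      · have hlt : T - t < δ := sub_lt_of_lt_lerayScale_mul ha ht.2 hr hA
        have ht' : t ∈ Ioo (T - δ) T := ⟨by linarith, ht.2⟩
        rw [indicator_of_mem hA, indicator_of_mem ht', ofReal_lerayScale_sq_rpow_mul ha ht.2]
      · rw [indicator_of_notMem hA]
        exact zero_le
    · rw [indicator_of_notMem ht]
      exact zero_le
  -- step 2: evaluate the time integral
  have step2 : ∫⁻ t in Ioo (T - δ) T, ENNReal.ofReal ((2 * a * (T - t)) ^ (-(1 / 6) : ℝ)) =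
      ENNReal.ofReal ((2 * a) ^ (-(1 / 6) : ℝ)) * ENNReal.ofReal (6 / 5 * δ ^ (5 / 6 : ℝ)) := by
    rw [setLIntegral_Ioo_comp_sub_left (fun s => ENNReal.ofReal ((2 * a * s) ^ (-(1 / 6) : ℝ))) T δ,
      ← setLIntegral_Ioo_rpow_neg_sixth hδpos, ← lintegral_const_mul _
        (show Measurable fun s : ℝ => ENNReal.ofReal (s ^ (-(1 / 6) : ℝ)) from
          (measurable_id.pow_const _).ennreal_ofReal)]
    refine setLIntegral_congr_fun measurableSet_Ioo fun s hs => ?_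
    rw [← ENNReal.ofReal_mul (Real.rpow_nonneg h2a.le _), ← Real.mul_rpow h2a.le hs.1.le]
  -- step 3: algebra
  have step3 : (2 * a) ^ (-(1 / 6) : ℝ) * (6 / 5 * δ ^ (5 / 6 : ℝ)) =
      6 / 5 * (2 * a)⁻¹ * ρ ^ (5 / 3 : ℝ) * r ^ (-(5 / 3) : ℝ) := by
    have hρ53 : (ρ ^ 2) ^ (5 / 6 : ℝ) = ρ ^ (5 / 3 : ℝ) := by
      rw [← Real.rpow_natCast ρ 2, ← Real.rpow_mul hρ.le]; norm_num
    have hr53 : (r ^ 2) ^ (5 / 6 : ℝ) = r ^ (5 / 3 : ℝ) := by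
      rw [← Real.rpow_natCast r 2, ← Real.rpow_mul hr.le]; norm_num
    have hδ56 : δ ^ (5 / 6 : ℝ) = ρ ^ (5 / 3 : ℝ) / ((2 * a) ^ (5 / 6 : ℝ) * r ^ (5 / 3 : ℝ)) := by
      rw [hδ, Real.div_rpow (sq_nonneg _) (by positivity), Real.mul_rpow h2a.le (sq_nonneg _),
        hρ53, hr53]
    have hA1 : (2 * a) ^ (1 / 6 : ℝ) * (2 * a) ^ (5 / 6 : ℝ) = 2 * a := by
      rw [← Real.rpow_add h2a]; norm_num
    have hA6 : (2 * a) ^ (1 / 6 : ℝ) ≠ 0 := (Real.rpow_pos_of_pos h2a _).ne'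
    have hA56 : (2 * a) ^ (5 / 6 : ℝ) ≠ 0 := (Real.rpow_pos_of_pos h2a _).ne'
    have hr53pos : r ^ (5 / 3 : ℝ) ≠ 0 := (Real.rpow_pos_of_pos hr _).ne'
    have key : (2 * a)⁻¹ = ((2 * a) ^ (1 / 6 : ℝ))⁻¹ * ((2 * a) ^ (5 / 6 : ℝ))⁻¹ := by
      rw [← mul_inv, hA1]
    rw [hδ56, Real.rpow_neg h2a.le, Real.rpow_neg hr.le, key]
    field_simp
  calc _ ≤ _ := step1
    _ = _ := step2
    _ = ENNReal.ofReal (6 / 5 * (2 * a)⁻¹ * ρ ^ (5 / 3 : ℝ) * r ^ (-(5 / 3) : ℝ)) := by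
        rw [← ENNReal.ofReal_mul (Real.rpow_nonneg h2a.le _), step3]
    _ = ENNReal.ofReal (6 / 5 * (2 * a)⁻¹ * ρ ^ (5 / 3 : ℝ)) * ‖y‖ₑ ^ (-(5 / 3) : ℝ) := by
        rw [ENNReal.ofReal_mul hC.le, ← ofReal_norm, ENNReal.ofReal_rpow_of_pos hr]

end Weights

/-! ### The two weighted profile bounds of Tsai 1998, (4.1)–(4.3), and the converse for `p` -/

section Profile

variable {a T ρ : ℝ}

/-- **(4.1)₂ for the dissipation.** If the self-similar field `u = lerayBackward a T U` of a `C¹`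
profile has `∫∫_{Q_ρ(0,T)} |∇u|² < ∞`, then `∫ |∇U(y)|² min(1, |y|⁻¹) dy < ∞` (Tsai 1998, (4.1):
`∫∫_{Q₁} |∇u|² = ∫ |∇U|² A₂ min(|y|⁻¹, λ₀⁻¹) dy`, "Hence all the right-hand sides are finite";
here with the explicit lower bound `lintegral_lerayScale_weight_one_ge` of the time weight). [cite: Tsai1998, (4.1) p. 44] -/
theorem lintegral_frobeniusNormSq_profile_weight_lt_top (ha : 0 < a) (hρ : 0 < ρ) {U : (EuclideanSpace ℝ (Fin 3)) → (EuclideanSpace ℝ (Fin 3))}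
    (hU : ContDiff ℝ 1 U)
    (hgrad : ∫⁻ t in Ioo (T - ρ ^ 2) T, ∫⁻ x in ball (0 : (EuclideanSpace ℝ (Fin 3))) ρ,
      ENNReal.ofReal (frobeniusNormSq (fderiv ℝ (lerayBackward a T U t) x)) < ∞) :
    ∫⁻ y, ENNReal.ofReal (frobeniusNormSq (fderiv ℝ U y)) * ENNReal.ofReal (min 1 ‖y‖⁻¹) < ∞ := by
  set F : (EuclideanSpace ℝ (Fin 3)) → ℝ≥0∞ := fun y => ENNReal.ofReal (frobeniusNormSq (fderiv ℝ U y)) with hF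
  have hfrob : Continuous (frobeniusNormSq : ((EuclideanSpace ℝ (Fin 3)) →L[ℝ] (EuclideanSpace ℝ (Fin 3))) → ℝ) := by
    unfold frobeniusNormSq
    exact continuous_finsetSum _ fun i _ =>
      ((ContinuousLinearMap.apply ℝ (EuclideanSpace ℝ (Fin 3)) (stdOrthonormalBasis ℝ (EuclideanSpace ℝ (Fin 3)) i)).continuous.norm).pow 2
  have hFm : Measurable F :=
    (hfrob.comp (hU.continuous_fderiv one_ne_zero)).measurable.ennreal_ofReal
  set lam : ℝ → ℝ := fun t => (Real.sqrt (2 * a * (T - t)))⁻¹ with hlam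
  have hΦm : Measurable fun t => ENNReal.ofReal ((lam t) ^ 4) :=
    ((measurable_lerayScale a T).pow_const 4).ennreal_ofReal
  -- the physical integrand is `λ⁴ |∇U|²(λx)`
  have hslice : ∀ t ∈ Ioo (T - ρ ^ 2) T, ∫⁻ x in ball (0 : (EuclideanSpace ℝ (Fin 3))) ρ,
      ENNReal.ofReal (frobeniusNormSq (fderiv ℝ (lerayBackward a T U t) x)) =
      ENNReal.ofReal ((lam t) ^ 4) * ∫⁻ x in ball (0 : (EuclideanSpace ℝ (Fin 3))) ρ, F (lam t • x) := by
    intro t _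
    rw [← lintegral_const_mul _
      (show Measurable fun x : (EuclideanSpace ℝ (Fin 3)) => F (lam t • x) from hFm.comp (measurable_const_smul _))]
    refine setLIntegral_congr_fun measurableSet_ball fun x _ => ?_
    rw [fderiv_lerayBackward, frobeniusNormSq_smul, hF]
    simp only
    rw [← ENNReal.ofReal_mul (by positivity), ← pow_mul]
  rw [setLIntegral_congr_fun measurableSet_Ioo hslice,
    setLIntegral_mul_setLIntegral_ball_comp_lerayScale ha measurableSet_Ioo (fun t ht => ht.2) hFm
      hΦm ρ] at hgrad
  -- compare the weights
  set c : ℝ := ρ * min (Real.sqrt (2 * a))⁻¹ (2 * a)⁻¹ with hc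
  have hcpos : 0 < c := by positivity
  have hle : ENNReal.ofReal c * ∫⁻ y, F y * ENNReal.ofReal (min 1 ‖y‖⁻¹) ≤
      ∫⁻ y, F y * ∫⁻ t in Ioo (T - ρ ^ 2) T, {t : ℝ | ‖y‖ < lam t * ρ}.indicator
        (fun t => ENNReal.ofReal ((lam t) ^ 4) * ENNReal.ofReal (((lam t) ^ 3)⁻¹)) t := by
    rw [← lintegral_const_mul' _ _ ENNReal.ofReal_ne_top]
    refine lintegral_mono fun y => ?_
    rw [mul_left_comm]
    refine mul_le_mul_right ?_ _
    rw [← ENNReal.ofReal_mul hcpos.le]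
    exact lintegral_lerayScale_weight_one_ge ha hρ T y
  have hfin := lt_of_le_of_lt hle hgrad
  exact ENNReal.lt_top_of_mul_ne_top_right hfin.ne (ENNReal.ofReal_pos.2 hcpos).ne'

/-- **The converse direction for the pressure** (Tsai 1998, p. 46: "`p ∈ L^{5/3}(Q₁)` since
`P̃ ∈ L^{5/3}_w`"). If `∫ |P(y) − k|^{5/3} |y|^{-5/3} dy < ∞` for a measurable `P`, then the
self-similar pressure `p(t, x) = λ(t)² (P(λ(t)x) − k)` lies in `L^{5/3}` of the cylinder
`Q_ρ(0, T)`: `∫_{T−ρ²}^T ∫_{B_ρ} |p|^{5/3} dx dt < ∞` (change of variables with the time weight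
bounded by `lintegral_lerayScale_weight_third_le`). [cite: Tsai1998, Lemma 4.1 p. 46] -/
theorem lintegral_selfSimilarPressure_rpow_lt_top (ha : 0 < a) (hρ : 0 < ρ) {P : (EuclideanSpace ℝ (Fin 3)) → ℝ}
    (hP : Measurable P) (k : ℝ)
    (hPk : ∫⁻ y, ‖P y - k‖ₑ ^ (5 / 3 : ℝ) * ‖y‖ₑ ^ (-(5 / 3) : ℝ) < ∞) :
    ∫⁻ t in Ioo (T - ρ ^ 2) T, ∫⁻ x in ball (0 : (EuclideanSpace ℝ (Fin 3))) ρ,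
      ‖((Real.sqrt (2 * a * (T - t)))⁻¹) ^ 2 * (P ((Real.sqrt (2 * a * (T - t)))⁻¹ • x) - k)‖ₑ ^
        (5 / 3 : ℝ) < ∞ := by
  set F : (EuclideanSpace ℝ (Fin 3)) → ℝ≥0∞ := fun y => ‖P y - k‖ₑ ^ (5 / 3 : ℝ) with hF
  have hFm : Measurable F := (hP.sub_const k).enorm.pow_const _
  set lam : ℝ → ℝ := fun t => (Real.sqrt (2 * a * (T - t)))⁻¹ with hlam
  have hΦm : Measurable fun t => ENNReal.ofReal ((lam t) ^ 2) ^ (5 / 3 : ℝ) :=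
    ((measurable_lerayScale a T).pow_const 2).ennreal_ofReal.pow_const _
  have hslice : ∀ t ∈ Ioo (T - ρ ^ 2) T, ∫⁻ x in ball (0 : (EuclideanSpace ℝ (Fin 3))) ρ,
      ‖(lam t) ^ 2 * (P (lam t • x) - k)‖ₑ ^ (5 / 3 : ℝ) =
      ENNReal.ofReal ((lam t) ^ 2) ^ (5 / 3 : ℝ) * ∫⁻ x in ball (0 : (EuclideanSpace ℝ (Fin 3))) ρ, F (lam t • x) := by
    intro t _
    rw [← lintegral_const_mul _
      (show Measurable fun x : (EuclideanSpace ℝ (Fin 3)) => F (lam t • x) from hFm.comp (measurable_const_smul _))]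
    refine setLIntegral_congr_fun measurableSet_ball fun x _ => ?_
    simp only [hF]
    rw [enorm_mul, Real.enorm_eq_ofReal (sq_nonneg _), ENNReal.mul_rpow_of_nonneg _ _ (by norm_num)]
  rw [setLIntegral_congr_fun measurableSet_Ioo hslice,
    setLIntegral_mul_setLIntegral_ball_comp_lerayScale ha measurableSet_Ioo (fun t ht => ht.2) hFm
      hΦm ρ]
  set C : ℝ := 6 / 5 * (2 * a)⁻¹ * ρ ^ (5 / 3 : ℝ) with hC
  calc ∫⁻ y, F y * ∫⁻ t in Ioo (T - ρ ^ 2) T, {t : ℝ | ‖y‖ < lam t * ρ}.indicator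
          (fun t => ENNReal.ofReal ((lam t) ^ 2) ^ (5 / 3 : ℝ) *
            ENNReal.ofReal (((lam t) ^ 3)⁻¹)) t
      ≤ ∫⁻ y, F y * (ENNReal.ofReal C * ‖y‖ₑ ^ (-(5 / 3) : ℝ)) :=
        lintegral_mono fun y => mul_le_mul_right (lintegral_lerayScale_weight_third_le ha hρ T y) _
    _ = ENNReal.ofReal C * ∫⁻ y, ‖P y - k‖ₑ ^ (5 / 3 : ℝ) * ‖y‖ₑ ^ (-(5 / 3) : ℝ) := by
        rw [← lintegral_const_mul' _ _ ENNReal.ofReal_ne_top]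
        refine lintegral_congr fun y => ?_
        simp only [hF]
        ring
    _ < ∞ := ENNReal.mul_lt_top ENNReal.ofReal_lt_top hPk

/-- **Product sets versus iterated integrals** (Tonelli on `ℝ × ℝ³`): for `f ≥ 0` a.e.-measurable
on `I × B`, `∫_{I × B} f = ∫_I ∫_B f(t, x) dx dt`; used with the parabolic cylinder
`Q_ρ(T, x₀) = (T − ρ², T) × B_ρ(x₀)`. [folklore] -/
theorem setLIntegral_prod_eq_setLIntegral_setLIntegral {I : Set ℝ} {B : Set (EuclideanSpace ℝ (Fin 3))}
    (f : ℝ × (EuclideanSpace ℝ (Fin 3)) → ℝ≥0∞) (hf : AEMeasurable f (volume.restrict (I ×ˢ B))) :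
    ∫⁻ z in I ×ˢ B, f z = ∫⁻ t in I, ∫⁻ x in B, f (t, x) := by
  have hf' : AEMeasurable f (((volume : Measure ℝ).restrict I).prod ((volume : Measure (EuclideanSpace ℝ (Fin 3))).restrict B)) := by
    rwa [Measure.prod_restrict, ← Measure.volume_eq_prod]
  rw [Measure.volume_eq_prod, ← Measure.prod_restrict, lintegral_prod _ hf']

end Profile

end Literature.Analysis.FluidPDE

end
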